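import Summits.SmoothPoincare4.SmoothPoincare4.Theses.VerlindeRLinks
import HarnessLib.Audit

/-!
# Negative lemmas for crux `VerlindeRLinks.VrlSlideGap` (stmt-SmoothPoincare4-16178): small component counts

Refuter crux-attack (2026-08-17), degenerate-instance analysis of the crux
`VrlSlideGap = ∃ (R-link L with n components) , ∀ 0-framed unlinks U, ¬ (L strictly slides to U)`
(≡ `¬ StrictGeneralizedPropertyRConjecture`, refuter precision note 2026-08-16).

* `n = 0` — `no_gap_at_zero`: the no-slide clause FAILS for every `L : FramedLink (Fin 0)` (a framed
  link without components is its own `0`-framed unlink, `FramedLink.isZeroFramedUnlink_of_isEmpty`,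
  and strict slide equivalence is reflexive). So the crux is not witnessed for a silly reason at
  `n = 0`; `gap_witness_pos`: every witness has `0 < n`.
* `n = 1` — `framing_eq_of_isStrictHandleSlideEquivalent_one`: with ONE component there is no strict
  handle slide (`FramedLink.IsStrictHandleSlide` needs two distinct indices `i ≠ j : Fin 1`), and the
  remaining generators (isotopy — equal framings by definition —, renumbering along `Fin 1 ≃ Fin 1`,
  reversal) preserve the framing; hence strict handle-slide equivalence of one-component framed
  links preserves the framing integer (an `EqvGen` induction over the sigma type `FramedLinkFin`
  carrying the component count). Consequently (`not_equiv_zeroFramedUnlink_of_framing_ne_zero`)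
  the no-slide clause holds for EVERY one-component framed link of non-zero framing, e.g. `(K, 1)`:
  at `n = 1` the clause carries no slide content at all, and a witness of the crux with `n = 1`
  would be a framed knot `(K, m)` with surgery `S² × S¹` that is not (up to isotopy and reversal) a
  disc-bounding knot with `m = 0` — excluded in print by Gabai's Property R (J. Differential Geom. 26
  (1987), Cor. 8.3; tree fact `isUnknot_of_isIntegralSurgery_zero`) together with `H₁(S² × S¹) ≅ ℤ`.
  So any witness lives at `n ≥ 2` (Property 2R and beyond), as the planner's sources say
  (Gompf–Scharlemann–Thompson 2010, §2: "for `n = 1` no slides are possible").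
* The same invariant shows that DROPPING the surgery conjuncts makes the crux trivially true
  (`(unknot, 1)` slides to no `0`-framed unlink): the R-link hypothesis
  `IsSphereTwoProdCircleSum n Y ∧ L.IsSurgery (𝓡 3) Y` is what carries the content.

No definition is introduced or changed (the `n = 1` invariant is phrased as a relation on `FramedLinkFin`).
References: [GompfScharlemannThompson2010, §2]; [GabaiJDG1987, Cor. 8.3]; [Kirby1978, §1].
-/

noncomputable section

-- every `Summit.SmoothPoincare4.SmoothPoincare4.…` name repeats the summit = sub-problem segment
-- (D-0017 layout); the duplicate is deliberate.
set_option linter.dupNamespace false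

namespace Summit.SmoothPoincare4.SmoothPoincare4.Theorems.VrlSlideGap.Negative

open scoped Manifold ContDiff
open Literature.Topology.FourManifolds
open Summit.SmoothPoincare4.SmoothPoincare4.Theses.VerlindeRLinks (VrlSlideGap)

/-! ## `n = 0` -/

/-- **No witness of the slide gap has `n = 0`**: the empty framed link is its own `0`-framed unlink
and strict handle-slide equivalence is reflexive. [folklore] -/
theorem no_gap_at_zero [Knot.TubularNbhd.SmoothnessFacts] (L : FramedLink (Fin 0)) :
    ¬ ∀ U : FramedLink (Fin 0), U.IsZeroFramedUnlink →
      ¬ IsStrictHandleSlideEquivalent ⟨0, L⟩ ⟨0, U⟩ :=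
  fun h ↦ h L L.isZeroFramedUnlink_of_isEmpty (Relation.EqvGen.refl _)

/-- **Every witness of `VrlSlideGap` has `0 < n`** (the crux restated with the harmless extra
conjunct; pure logic over `no_gap_at_zero`). [folklore] -/
theorem gap_witness_pos (h : VrlSlideGap) :
    ∃ (_ : Knot.TubularNbhd.SmoothnessFacts) (n : ℕ) (L : FramedLink (Fin n)) (Y : Type)
      (_ : TopologicalSpace Y) (_ : T2Space Y) (_ : SecondCountableTopology Y)
      (_ : ChartedSpace (EuclideanSpace ℝ (Fin 3)) Y) (_ : IsManifold (𝓡 3) ∞ Y)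
      (_ : CompactSpace Y) (_ : ConnectedSpace Y), 0 < n ∧ IsSphereTwoProdCircleSum n Y ∧
      L.IsSurgery (𝓡 3) Y ∧ ∀ U : FramedLink (Fin n), U.IsZeroFramedUnlink →
        ¬ IsStrictHandleSlideEquivalent ⟨n, L⟩ ⟨n, U⟩ := by
  obtain ⟨inst, n, L, Y, i₁, i₂, i₃, i₄, i₅, i₆, i₇, hY, hL, hgap⟩ := h
  refine ⟨inst, n, L, Y, i₁, i₂, i₃, i₄, i₅, i₆, i₇, ?_, hY, hL, hgap⟩
  rcases n with _ | n
  · exact absurd hgap (no_gap_at_zero L)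
  · exact Nat.succ_pos n

/-! ## `n = 1`: strict handle-slide equivalence of one-component framed links preserves the framing -/

/-- **Each strict handle-slide move preserves the number of components and, for one component, the
framing**: isotopic framed links have equal framings; renumbering along `e : Fin 1 ≃ Fin 1` fixes
the unique index; reversal keeps framings; and a strict handle slide needs two distinct components,
impossible in `Fin 1`. (Stated as a relation on the sigma type `FramedLinkFin`, so that the
`EqvGen` induction below needs no auxiliary definition.) [folklore] -/
theorem framing_rel_of_strictHandleSlideMove [Knot.TubularNbhd.SmoothnessFacts]
    {a b : FramedLinkFin} (h : StrictHandleSlideMove a b) :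
    a.1 = b.1 ∧ ∀ (ha : a.1 = 1) (hb : b.1 = 1),
      a.2.framing ⟨0, by omega⟩ = b.2.framing ⟨0, by omega⟩ := by
  cases h with
  | @isotopy n L L' hiso =>
      refine ⟨rfl, fun ha _ ↦ ?_⟩
      change L.framing _ = L'.framing _
      rw [hiso.2]
  | @reindex n e L =>
      refine ⟨rfl, fun ha _ ↦ ?_⟩
      change L.framing _ = (L.reindex e).framing _
      dsimp only at ha
      subst ha
      rw [FramedLink.reindex_framing]
      congr 1
      exact Subsingleton.elim _ _
  | @reverseComponent n i L =>
      exact ⟨rfl, fun _ _ ↦ rfl⟩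
  | @handleSlide n L L' hs =>
      refine ⟨rfl, fun ha _ ↦ ?_⟩
      dsimp only at ha
      subst ha
      obtain ⟨i, j, hij, -⟩ := hs
      exact absurd (Subsingleton.elim i j) hij

/-- **Strict handle-slide equivalence preserves the number of components and, for one component,
the framing** (`EqvGen` induction over `framing_rel_of_strictHandleSlideMove`; the relation is
reflexive, symmetric and transitive because the component count is carried along). [folklore] -/
theorem framing_rel_of_isStrictHandleSlideEquivalent [Knot.TubularNbhd.SmoothnessFacts]
    {a b : FramedLinkFin} (h : IsStrictHandleSlideEquivalent a b) :
    a.1 = b.1 ∧ ∀ (ha : a.1 = 1) (hb : b.1 = 1),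
      a.2.framing ⟨0, by omega⟩ = b.2.framing ⟨0, by omega⟩ := by
  induction h with
  | rel _ _ h => exact framing_rel_of_strictHandleSlideMove h
  | refl _ => exact ⟨rfl, fun _ _ ↦ rfl⟩
  | symm x y _ ih => exact ⟨ih.1.symm, fun hy hx ↦ (ih.2 hx hy).symm⟩
  | trans x y z _ _ ih₁ ih₂ =>
      refine ⟨ih₁.1.trans ih₂.1, fun hx hz ↦ ?_⟩
      have hy : y.1 = 1 := ih₁.1 ▸ hx
      exact (ih₁.2 hx hy).trans (ih₂.2 hy hz)

/-- **One component: strictly slide-equivalent framed knots have the same framing** (there are no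
slides; isotopy, renumbering and reversal keep the framing). Gompf–Scharlemann–Thompson (2010), §2
("for `n = 1` no slides are possible"). [cite: GompfScharlemannThompson2010, §2] -/
theorem framing_eq_of_isStrictHandleSlideEquivalent_one [Knot.TubularNbhd.SmoothnessFacts]
    {L L' : FramedLink (Fin 1)} (h : IsStrictHandleSlideEquivalent ⟨1, L⟩ ⟨1, L'⟩) :
    L.framing 0 = L'.framing 0 :=
  (framing_rel_of_isStrictHandleSlideEquivalent h).2 rfl rfl

/-- **At `n = 1` the no-slide clause of the crux holds for every framed knot of non-zero framing**
(e.g. `(K, 1)` for any knot `K`): such a framed knot is strictly slide-equivalent to no `0`-framed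
unlink. So at `n = 1` the clause has no slide content; combined with the surgery conjuncts a witness
with `n = 1` is excluded in print by Gabai's Property R, and witnesses live at `n ≥ 2`. It also shows
that the crux WITHOUT its surgery conjuncts is trivially true, i.e. the R-link hypothesis is the
load-bearing one. [folklore] -/
theorem not_equiv_zeroFramedUnlink_of_framing_ne_zero [Knot.TubularNbhd.SmoothnessFacts]
    {L : FramedLink (Fin 1)} (hL : L.framing 0 ≠ 0) (U : FramedLink (Fin 1))
    (hU : U.IsZeroFramedUnlink) : ¬ IsStrictHandleSlideEquivalent ⟨1, L⟩ ⟨1, U⟩ :=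
  fun h ↦ hL ((framing_eq_of_isStrictHandleSlideEquivalent_one h).trans (hU.2 0))

end Summit.SmoothPoincare4.SmoothPoincare4.Theorems.VrlSlideGap.Negative

end
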